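import Literature.AnabelianGeometry.SemiGraphs.TemperedGroups
import Literature.AnabelianGeometry.EtaleTheta.Discharge.Sec2CompletionQuotients
import Mathlib.GroupTheory.FreeGroup.GeneratorEquiv
import HarnessLib

/-!
# Products of a tempered group with a profinite group: completion, temperedness, the free tower

Mochizuki, *Semi-graphs of anabelioids*, Publ. RIMS **42** (2006) [SemiAnbd], §3 Def. 3.1 (i)
(tempered groups), Rmk. 3.1.1 ("every profinite group is tempered"), §6 p. 69 (profinite
completions). [cite: MochizukiSemiAnbd2006, Def 3.1(i) p.33; §6 p.69]

PROOF-ONLY file (abc-iut cell, prover abc-iut-w5-d240; theorems only, no definitions): three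
structural lemmas over L3's interfaces `IsTempered` / `IsProfiniteCompletion` for the product of a
topological group `Π` with a PROFINITE group `Γ` (compact, Hausdorff, totally disconnected):

* `IsProfiniteCompletion.prodMap_id` — if `ι : Π → Π̂` is a profinite completion, so is
  `ι × id_Γ : Π × Γ → Π̂ × Γ` (a finite-index open normal `U ⊴ Π × Γ` contains the product of its
  traces `U_Π × U_Γ`, `U_Π = ι⁻¹(V_Π)`, and `U` is the preimage of its image in the finite group
  `(Π̂/V_Π) × (Γ/U_Γ)`);
* `IsTempered.prod_of_profinite` — if `Π` is tempered, so is `Π × Γ` (bases, separation and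
  completeness checked on the cofinal open normal subgroups `N × W`);
* `tower_prod_of_profinite` — the "virtually free tower" input of the tree's [SemiAnbd] §6 proofs
  (cofinal open normal `N` with `Π/N ⊇` a non-abelian free normal subgroup of finite index and finite
  rank) passes from `Π` to `Π × Γ` (at `N × W`, `(Π × Γ)/(N × W) ⊇ G × 1 ≅ G`).

Used by the vacuity witness `TemperedAnabelianTowerWitnessCurve.lean`.  Classical topological group
theory; nothing here concerns the disputed parts of inter-universal Teichmüller theory or takes a side
on [IUTchIII] Cor. 3.12.
-/

noncomputable section

namespace Literature.AnabelianGeometry.SemiGraphs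

open _root_.Topology
open Literature.AnabelianGeometry.EtaleTheta.DiscreteNormalizers

universe u v w

section Products

variable {P : Type u} [Group P] [TopologicalSpace P]
variable {Ph : Type v} [Group Ph] [TopologicalSpace Ph] [IsTopologicalGroup Ph]
variable {Γ : Type w} [Group Γ] [TopologicalSpace Γ] [IsTopologicalGroup Γ] [CompactSpace Γ]
  [T2Space Γ] [TotallyDisconnectedSpace Γ]

omit [T2Space Γ] in
/-- A neighbourhood of `1` in `Π × Γ` contains `U₁ × W` with `U₁` a neighbourhood of `1` in `Π` and
`W` an open normal subgroup of the profinite group `Γ`. [folklore] -/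
private theorem exists_nhds_prod_openNormal {U : Set (P × Γ)} (hU : U ∈ 𝓝 (1 : P × Γ)) :
    ∃ U₁ ∈ 𝓝 (1 : P), ∃ W : OpenNormalSubgroup Γ, U₁ ×ˢ (W : Set Γ) ⊆ U := by
  rw [show (1 : P × Γ) = (1, 1) from rfl, mem_nhds_prod_iff'] at hU
  obtain ⟨u, v, hu, h1u, hv, h1v, huv⟩ := hU
  obtain ⟨W, hW⟩ := ProfiniteGrp.exist_openNormalSubgroup_sub_open_nhds_of_one hv h1v
  exact ⟨u, hu.mem_nhds h1u, W, fun x hx => huv ⟨hx.1, hW hx.2⟩⟩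

/-- **`ι × id : Π × Γ → Π̂ × Γ` is a profinite completion** (in the sense of L3's interface) whenever
`ι : Π → Π̂` is one and `Γ` is profinite: a finite-index open normal `U ⊴ Π × Γ` contains
`U_Π × U_Γ` (its traces on the factors), `U_Π = ι⁻¹(V_Π)`, and `U` is the preimage of its image in
the finite group `(Π̂/V_Π) × (Γ/U_Γ)`. [cite: MochizukiSemiAnbd2006, §6 p.69] -/
theorem IsProfiniteCompletion.prodMap_id {ι : P →ₜ* Ph} (hι : IsProfiniteCompletion ι) :
    IsProfiniteCompletion (ι.prodMap (ContinuousMonoidHom.id Γ)) := by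
  haveI : CompactSpace Ph := hι.compactSpace
  haveI : T2Space Ph := hι.t2Space
  haveI : TotallyDisconnectedSpace Ph := hι.totallyDisconnectedSpace
  refine ⟨inferInstance, inferInstance, inferInstance, ?_, ?_, ?_⟩
  · exact hι.denseRange.prodMap denseRange_id
  · intro U hU
    haveI := hU
    -- traces on the factors
    let UP : Subgroup P := U.toSubgroup.comap (MonoidHom.inl P Γ)
    let UΓ : Subgroup Γ := U.toSubgroup.comap (MonoidHom.inr P Γ)
    have hUPo : IsOpen (UP : Set P) :=
      U.toOpenSubgroup.isOpen.preimage
        (continuous_id.prodMk continuous_const : Continuous fun x : P => (x, (1 : Γ)))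
    have hUΓo : IsOpen (UΓ : Set Γ) :=
      U.toOpenSubgroup.isOpen.preimage
        (continuous_const.prodMk continuous_id : Continuous fun x : Γ => ((1 : P), x))
    haveI hUPfi : UP.FiniteIndex := by
      haveI : U.toSubgroup.IsFiniteRelIndex (MonoidHom.inl P Γ).range :=
        Subgroup.isFiniteRelIndex_of_finiteIndex
      exact ⟨by rw [Subgroup.index_comap]; exact Subgroup.relIndex_ne_zero⟩
    let UP' : OpenNormalSubgroup P :=
      { toOpenSubgroup := ⟨UP, hUPo⟩, isNormal' := Subgroup.Normal.comap inferInstance _ }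
    obtain ⟨VP, hVP⟩ := hι.comap_surjective UP' hUPfi
    have hVP' : UP = VP.toSubgroup.comap ι.toMonoidHom := hVP
    haveI : UΓ.Normal := Subgroup.Normal.comap inferInstance _
    -- the finite quotient `(Π̂/V_Π) × (Γ/U_Γ)` and the maps into it
    let Φ : Ph × Γ →* (Ph ⧸ VP.toSubgroup) × (Γ ⧸ UΓ) :=
      (QuotientGroup.mk' VP.toSubgroup).prodMap (QuotientGroup.mk' UΓ)
    let f : P × Γ →* (Ph ⧸ VP.toSubgroup) × (Γ ⧸ UΓ) :=
      Φ.comp (ι.prodMap (ContinuousMonoidHom.id Γ)).toMonoidHom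
    have hf : ∀ x : P × Γ, f x = Φ (ι x.1, x.2) := fun _ => rfl
    have hfsurj : Function.Surjective f := by
      rintro ⟨c, d⟩
      obtain ⟨y, rfl⟩ := QuotientGroup.mk_surjective c
      obtain ⟨δ, rfl⟩ := QuotientGroup.mk_surjective d
      obtain ⟨g, hg⟩ := exists_inv_mul_mem_of_denseRange ι hι.denseRange
        VP.toOpenSubgroup.isOpen y
      refine ⟨(g, δ), ?_⟩
      rw [hf]
      change ((QuotientGroup.mk (ι g) : Ph ⧸ VP.toSubgroup), (QuotientGroup.mk δ : Γ ⧸ UΓ)) = _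
      rw [Prod.mk.injEq]
      exact ⟨(QuotientGroup.eq.mpr hg).symm, rfl⟩
    let S : Subgroup ((Ph ⧸ VP.toSubgroup) × (Γ ⧸ UΓ)) := U.toSubgroup.map f
    haveI hSn : S.Normal := Subgroup.Normal.map inferInstance f hfsurj
    let V : Subgroup (Ph × Γ) := S.comap Φ
    -- `V` is open: it contains the open subgroup `V_Π × U_Γ = ker Φ`
    have hVopen : IsOpen (V : Set (Ph × Γ)) := by
      refine Subgroup.isOpen_mono (H₁ := VP.toSubgroup.prod UΓ) ?_
        (VP.toOpenSubgroup.isOpen.prod hUΓo)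
      rintro ⟨y, δ⟩ hyδ
      rw [Subgroup.mem_prod] at hyδ
      change Φ (y, δ) ∈ S
      have h1 : Φ (y, δ) = 1 := by
        change ((QuotientGroup.mk y : Ph ⧸ VP.toSubgroup), (QuotientGroup.mk δ : Γ ⧸ UΓ)) = 1
        rw [Prod.mk_eq_one, QuotientGroup.eq_one_iff, QuotientGroup.eq_one_iff]
        exact hyδ
      rw [h1]
      exact S.one_mem
    refine ⟨{ toOpenSubgroup := ⟨V, hVopen⟩, isNormal' := Subgroup.Normal.comap hSn Φ }, ?_⟩
    -- `U = (ι × id)⁻¹(V)`: `f⁻¹(f(U)) = U ⊔ ker f = U` since `ker f = U_Π × U_Γ ≤ U`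
    change U.toSubgroup = (S.comap Φ).comap (ι.prodMap (ContinuousMonoidHom.id Γ)).toMonoidHom
    rw [Subgroup.comap_comap]
    change U.toSubgroup = (U.toSubgroup.map f).comap f
    rw [Subgroup.comap_map_eq, eq_comm, sup_eq_left]
    rintro ⟨x, δ⟩ hx
    rw [MonoidHom.mem_ker, hf] at hx
    change ((QuotientGroup.mk (ι x) : Ph ⧸ VP.toSubgroup), (QuotientGroup.mk δ : Γ ⧸ UΓ)) = 1 at hx
    rw [Prod.mk_eq_one, QuotientGroup.eq_one_iff, QuotientGroup.eq_one_iff] at hx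
    have hxU : (x, (1 : Γ)) ∈ U.toSubgroup := by
      have : x ∈ UP := by rw [hVP']; exact hx.1
      exact this
    have hδU : ((1 : P), δ) ∈ U.toSubgroup := hx.2
    have := U.toSubgroup.mul_mem hxU hδU
    simpa using this
  · intro V
    exact V.toOpenSubgroup.isOpen.preimage (ι.prodMap (ContinuousMonoidHom.id Γ)).continuous

omit [T2Space Γ] in
/-- **`Π × Γ` is tempered whenever `Π` is tempered and `Γ` is profinite** ([SemiAnbd] Def. 3.1 (i);
Rmk. 3.1.1 "every profinite group is tempered"): bases, separation and completeness are checked on the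
open normal subgroups `N × W` (`N ⊴ Π` open normal, `W ⊴ Γ` open normal), which are cofinal.
[cite: MochizukiSemiAnbd2006, Def 3.1(i) p.33] -/
theorem IsTempered.prod_of_profinite (hP : IsTempered P) : IsTempered (P × Γ) := by
  classical
  have hΓ : IsTempered Γ := IsTempered.of_profinite
  -- products `N × W` of open normal subgroups, packaged opaquely with their membership criterion
  obtain ⟨onsProd, mem_onsProd⟩ :
      ∃ f : OpenNormalSubgroup P → OpenNormalSubgroup Γ → OpenNormalSubgroup (P × Γ),
        ∀ {N : OpenNormalSubgroup P} {W : OpenNormalSubgroup Γ} {x : P × Γ},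
          x ∈ (f N W).toSubgroup ↔ x.1 ∈ N.toSubgroup ∧ x.2 ∈ W.toSubgroup :=
    ⟨fun N W => { toOpenSubgroup := N.toOpenSubgroup.prod W.toOpenSubgroup
                  isNormal' := Subgroup.prod_normal N.toSubgroup W.toSubgroup },
      fun {N W x} => Subgroup.mem_prod⟩
  refine ⟨?_, ?_, ?_⟩
  · -- (a) basis of open normal subgroups of countable index
    intro U hU
    obtain ⟨U₁, hU₁, W, hUW⟩ := exists_nhds_prod_openNormal hU
    obtain ⟨N, hNc, hNU⟩ := hP.basis U₁ hU₁
    haveI := hNc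
    haveI : Finite (Γ ⧸ W.toSubgroup) :=
      Subgroup.quotient_finite_of_isOpen W.toSubgroup W.toOpenSubgroup.isOpen
    refine ⟨onsProd N W, ?_, fun x hx => hUW ⟨hNU ((mem_onsProd.mp hx).1), (mem_onsProd.mp hx).2⟩⟩
    -- `(Π × Γ)/(N × W) ↪ Π/N × Γ/W`
    let φ : (P × Γ) ⧸ (onsProd N W).toSubgroup →* (P ⧸ N.toSubgroup) × (Γ ⧸ W.toSubgroup) :=
      QuotientGroup.lift (onsProd N W).toSubgroup
        ((QuotientGroup.mk' N.toSubgroup).prodMap (QuotientGroup.mk' W.toSubgroup)) (by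
          rintro ⟨a, b⟩ hab
          rw [mem_onsProd] at hab
          change ((QuotientGroup.mk a : P ⧸ N.toSubgroup), (QuotientGroup.mk b : Γ ⧸ W.toSubgroup)) = 1
          rw [Prod.mk_eq_one, QuotientGroup.eq_one_iff, QuotientGroup.eq_one_iff]
          exact hab)
    have hφ : Function.Injective φ := by
      rw [injective_iff_map_eq_one]
      intro q hq
      obtain ⟨⟨a, b⟩, rfl⟩ := QuotientGroup.mk_surjective q
      change ((QuotientGroup.mk a : P ⧸ N.toSubgroup), (QuotientGroup.mk b : Γ ⧸ W.toSubgroup)) = 1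
        at hq
      rw [Prod.mk_eq_one, QuotientGroup.eq_one_iff, QuotientGroup.eq_one_iff] at hq
      exact (QuotientGroup.eq_one_iff _).mpr (mem_onsProd.mpr hq)
    exact hφ.countable
  · -- (b) separation
    rintro ⟨a, b⟩ hab
    by_cases ha : a = 1
    · have hb : b ≠ 1 := fun hb => hab (by rw [ha, hb]; rfl)
      obtain ⟨W, hW⟩ := hΓ.separated b hb
      -- `⊤ × W`
      let T : OpenNormalSubgroup P :=
        { toOpenSubgroup := ⊤, isNormal' := ⟨fun n _ g => Subgroup.mem_top _⟩ }
      exact ⟨onsProd T W, fun h => hW (mem_onsProd.mp h).2⟩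
    · obtain ⟨N, hN⟩ := hP.separated a ha
      let T : OpenNormalSubgroup Γ :=
        { toOpenSubgroup := ⊤, isNormal' := ⟨fun n _ g => Subgroup.mem_top _⟩ }
      exact ⟨onsProd N T, fun h => hN (mem_onsProd.mp h).1⟩
  · -- (c) completeness
    intro x hx
    let TP : OpenNormalSubgroup P :=
      { toOpenSubgroup := ⊤, isNormal' := ⟨fun n _ g => Subgroup.mem_top _⟩ }
    let TΓ : OpenNormalSubgroup Γ :=
      { toOpenSubgroup := ⊤, isNormal' := ⟨fun n _ g => Subgroup.mem_top _⟩ }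
    -- first components: a compatible family over the open normal subgroups of `Π`
    let πP : ∀ N : OpenNormalSubgroup P,
        (P × Γ) ⧸ (onsProd N TΓ).toSubgroup →* P ⧸ N.toSubgroup := fun N =>
      QuotientGroup.lift (onsProd N TΓ).toSubgroup
        ((QuotientGroup.mk' N.toSubgroup).comp (MonoidHom.fst P Γ)) (by
        rintro ⟨a, b⟩ hab
        exact (QuotientGroup.eq_one_iff _).mpr (mem_onsProd.mp hab).1)
    have hπP : ∀ (N : OpenNormalSubgroup P) (a : P) (b : Γ),
        πP N (QuotientGroup.mk (a, b)) = QuotientGroup.mk a := fun _ _ _ => rfl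
    obtain ⟨p, hp⟩ := hP.complete (fun N => πP N (x (onsProd N TΓ))) (by
      intro N M hNM g hg
      obtain ⟨⟨a, b⟩, hab⟩ := QuotientGroup.mk_surjective (x (onsProd N TΓ))
      have hxM : x (onsProd M TΓ) = QuotientGroup.mk (a, b) :=
        hx (onsProd N TΓ) (onsProd M TΓ) (fun y hy => mem_onsProd.mpr
          ⟨hNM (mem_onsProd.mp hy).1, (mem_onsProd.mp hy).2⟩) (a, b) hab.symm
      change πP M (x (onsProd M TΓ)) = QuotientGroup.mk g
      rw [hxM, hπP]
      have h1 : πP N (x (onsProd N TΓ)) = QuotientGroup.mk g := hg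
      rw [← hab, hπP] at h1
      exact (QuotientGroup.eq.mpr (hNM (QuotientGroup.eq.mp h1)))
      )
    -- second components: a compatible family over the open normal subgroups of `Γ`
    let πΓ : ∀ W : OpenNormalSubgroup Γ,
        (P × Γ) ⧸ (onsProd TP W).toSubgroup →* Γ ⧸ W.toSubgroup := fun W =>
      QuotientGroup.lift (onsProd TP W).toSubgroup
        ((QuotientGroup.mk' W.toSubgroup).comp (MonoidHom.snd P Γ)) (by
        rintro ⟨a, b⟩ hab
        exact (QuotientGroup.eq_one_iff _).mpr (mem_onsProd.mp hab).2)
    have hπΓ : ∀ (W : OpenNormalSubgroup Γ) (a : P) (b : Γ),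
        πΓ W (QuotientGroup.mk (a, b)) = QuotientGroup.mk b := fun _ _ _ => rfl
    obtain ⟨γ, hγ⟩ := hΓ.complete (fun W => πΓ W (x (onsProd TP W))) (by
      intro W W' hWW' g hg
      obtain ⟨⟨a, b⟩, hab⟩ := QuotientGroup.mk_surjective (x (onsProd TP W))
      have hxW' : x (onsProd TP W') = QuotientGroup.mk (a, b) :=
        hx (onsProd TP W) (onsProd TP W') (fun y hy => mem_onsProd.mpr
          ⟨(mem_onsProd.mp hy).1, hWW' (mem_onsProd.mp hy).2⟩) (a, b) hab.symm
      change πΓ W' (x (onsProd TP W')) = QuotientGroup.mk g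
      rw [hxW', hπΓ]
      have h1 : πΓ W (x (onsProd TP W)) = QuotientGroup.mk g := hg
      rw [← hab, hπΓ] at h1
      exact (QuotientGroup.eq.mpr (hWW' (QuotientGroup.eq.mp h1))))
    refine ⟨(p, γ), fun N => ?_⟩
    -- shrink `N` to some `N₁ × W`
    obtain ⟨U₁, hU₁, W, hUW⟩ := exists_nhds_prod_openNormal (N.toOpenSubgroup.mem_nhds_one)
    obtain ⟨N₁, -, hN₁U⟩ := hP.basis U₁ hU₁
    have hle : onsProd N₁ W ≤ N := fun y hy =>
      hUW ⟨hN₁U (mem_onsProd.mp hy).1, (mem_onsProd.mp hy).2⟩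
    obtain ⟨⟨a, b⟩, hab⟩ := QuotientGroup.mk_surjective (x (onsProd N₁ W))
    -- compare with the two marginal families
    have hxP : x (onsProd N₁ TΓ) = QuotientGroup.mk (a, b) :=
      hx (onsProd N₁ W) (onsProd N₁ TΓ) (fun y hy => mem_onsProd.mpr
        ⟨(mem_onsProd.mp hy).1, Subgroup.mem_top _⟩) (a, b) hab.symm
    have hxΓ : x (onsProd TP W) = QuotientGroup.mk (a, b) :=
      hx (onsProd N₁ W) (onsProd TP W) (fun y hy => mem_onsProd.mpr
        ⟨Subgroup.mem_top _, (mem_onsProd.mp hy).2⟩) (a, b) hab.symm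
    have ha : a⁻¹ * p ∈ N₁.toSubgroup := by
      have h1 := hp N₁
      change πP N₁ (x (onsProd N₁ TΓ)) = QuotientGroup.mk p at h1
      rw [hxP, hπP] at h1
      exact QuotientGroup.eq.mp h1
    have hb : b⁻¹ * γ ∈ W.toSubgroup := by
      have h1 := hγ W
      change πΓ W (x (onsProd TP W)) = QuotientGroup.mk γ at h1
      rw [hxΓ, hπΓ] at h1
      exact QuotientGroup.eq.mp h1
    have hxNW : x (onsProd N₁ W) = QuotientGroup.mk (p, γ) := by
      rw [← hab]
      exact QuotientGroup.eq.mpr (mem_onsProd.mpr ⟨ha, hb⟩)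
    exact hx (onsProd N₁ W) N hle (p, γ) hxNW

omit [T2Space Γ] in
/-- **The tower input passes to products with a profinite group**: if `Π` has cofinally many open
normal `N` with `Π/N ⊇` a non-abelian free normal subgroup `G` of finite index and finite rank, then
so does `Π × Γ` (`Γ` profinite): at `N × W` the quotient `(Π × Γ)/(N × W) ≅ Π/N × Γ/W` contains
`G × 1`. [cite: MochizukiSemiAnbd2006, §6 p.69] -/
theorem tower_prod_of_profinite
    (htower₀ : ∀ U ∈ 𝓝 (1 : P), ∃ N : OpenNormalSubgroup P, (N : Set P) ⊆ U ∧
      ∃ (G : Subgroup (P ⧸ N.toSubgroup)) (_ : IsFreeGroup G), G.Normal ∧ G.FiniteIndex ∧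
        Finite (IsFreeGroup.Generators G) ∧ ∃ a ∈ G, ∃ b ∈ G, a * b ≠ b * a) :
    ∀ U ∈ 𝓝 (1 : P × Γ), ∃ N : OpenNormalSubgroup (P × Γ), (N : Set (P × Γ)) ⊆ U ∧
      ∃ (G : Subgroup ((P × Γ) ⧸ N.toSubgroup)) (_ : IsFreeGroup G), G.Normal ∧ G.FiniteIndex ∧
        Finite (IsFreeGroup.Generators G) ∧ ∃ a ∈ G, ∃ b ∈ G, a * b ≠ b * a := by
  classical
  -- products `N × W` of open normal subgroups, packaged opaquely with their membership criterion
  obtain ⟨onsProd, mem_onsProd⟩ :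
      ∃ f : OpenNormalSubgroup P → OpenNormalSubgroup Γ → OpenNormalSubgroup (P × Γ),
        ∀ {N : OpenNormalSubgroup P} {W : OpenNormalSubgroup Γ} {x : P × Γ},
          x ∈ (f N W).toSubgroup ↔ x.1 ∈ N.toSubgroup ∧ x.2 ∈ W.toSubgroup :=
    ⟨fun N W => { toOpenSubgroup := N.toOpenSubgroup.prod W.toOpenSubgroup
                  isNormal' := Subgroup.prod_normal N.toSubgroup W.toSubgroup },
      fun {N W x} => Subgroup.mem_prod⟩
  intro U hU
  obtain ⟨U₁, hU₁, W, hUW⟩ := exists_nhds_prod_openNormal hU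
  obtain ⟨N, hNU, G, hG, hGn, hGfi, hGfin, a, ha, b, hb, hab⟩ := htower₀ U₁ hU₁
  haveI := hG
  haveI := hGn
  haveI := hGfi
  haveI : Finite (Γ ⧸ W.toSubgroup) :=
    Subgroup.quotient_finite_of_isOpen W.toSubgroup W.toOpenSubgroup.isOpen
  refine ⟨onsProd N W, fun x hx => hUW ⟨hNU (mem_onsProd.mp hx).1, (mem_onsProd.mp hx).2⟩, ?_⟩
  -- the two projections of `(Π × Γ)/(N × W)`
  let φ : (P × Γ) ⧸ (onsProd N W).toSubgroup →* P ⧸ N.toSubgroup :=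
    QuotientGroup.lift (onsProd N W).toSubgroup
      ((QuotientGroup.mk' N.toSubgroup).comp (MonoidHom.fst P Γ)) (by
      rintro ⟨c, d⟩ hcd
      exact (QuotientGroup.eq_one_iff _).mpr (mem_onsProd.mp hcd).1)
  let ψ : (P × Γ) ⧸ (onsProd N W).toSubgroup →* Γ ⧸ W.toSubgroup :=
    QuotientGroup.lift (onsProd N W).toSubgroup
      ((QuotientGroup.mk' W.toSubgroup).comp (MonoidHom.snd P Γ)) (by
      rintro ⟨c, d⟩ hcd
      exact (QuotientGroup.eq_one_iff _).mpr (mem_onsProd.mp hcd).2)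
  have hφ : ∀ (c : P) (d : Γ), φ (QuotientGroup.mk (c, d)) = QuotientGroup.mk c := fun _ _ => rfl
  have hψ : ∀ (c : P) (d : Γ), ψ (QuotientGroup.mk (c, d)) = QuotientGroup.mk d := fun _ _ => rfl
  have hφsurj : Function.Surjective φ := by
    intro q
    obtain ⟨c, rfl⟩ := QuotientGroup.mk_surjective q
    exact ⟨QuotientGroup.mk (c, 1), hφ c 1⟩
  -- `G' := φ⁻¹(G) ∩ ker ψ ≅ G`
  let G' : Subgroup ((P × Γ) ⧸ (onsProd N W).toSubgroup) := G.comap φ ⊓ ψ.ker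
  haveI hG'n : G'.Normal := Subgroup.normal_inf_normal _ _
  haveI : (G.comap φ).FiniteIndex := by
    rw [Subgroup.finiteIndex_iff, Subgroup.index_comap_of_surjective _ hφsurj]
    exact hGfi.index_ne_zero
  haveI : ψ.ker.FiniteIndex := by
    haveI : Finite (((P × Γ) ⧸ (onsProd N W).toSubgroup) ⧸ ψ.ker) :=
      Finite.of_equiv _ (QuotientGroup.quotientKerEquivRange ψ).symm.toEquiv
    exact Subgroup.finiteIndex_of_finite_quotient
  haveI hG'fi : G'.FiniteIndex := inferInstance
  -- the isomorphism `G' ≃* G` induced by `φ`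
  have hmapsTo : ∀ x : G', φ x.1 ∈ G := fun x => (Subgroup.mem_inf.mp x.2).1
  let e₀ : G' →* G :=
    { toFun := fun x => ⟨φ x.1, hmapsTo x⟩
      map_one' := Subtype.ext (by simp)
      map_mul' := fun x y => Subtype.ext (by simp) }
  have he₀inj : Function.Injective e₀ := by
    rw [injective_iff_map_eq_one]
    rintro ⟨q, hq⟩ h1
    have h1' : φ q = 1 := congrArg Subtype.val h1
    obtain ⟨⟨c, d⟩, rfl⟩ := QuotientGroup.mk_surjective q
    have hq2 : ψ (QuotientGroup.mk (c, d)) = 1 := (Subgroup.mem_inf.mp hq).2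
    rw [hφ, QuotientGroup.eq_one_iff] at h1'
    rw [hψ, QuotientGroup.eq_one_iff] at hq2
    exact Subtype.ext ((QuotientGroup.eq_one_iff _).mpr (mem_onsProd.mpr ⟨h1', hq2⟩))
  have he₀surj : Function.Surjective e₀ := by
    rintro ⟨g, hg⟩
    obtain ⟨c, rfl⟩ := QuotientGroup.mk_surjective g
    refine ⟨⟨QuotientGroup.mk (c, 1), Subgroup.mem_inf.mpr ⟨?_, ?_⟩⟩, Subtype.ext (hφ c 1)⟩
    · change φ (QuotientGroup.mk (c, 1)) ∈ G
      rw [hφ]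
      exact hg
    · rw [MonoidHom.mem_ker, hψ]
      rfl
  let e : G' ≃* G := MulEquiv.ofBijective e₀ ⟨he₀inj, he₀surj⟩
  haveI hfree : IsFreeGroup G' := IsFreeGroup.ofMulEquiv e.symm
  have hfin : Finite (IsFreeGroup.Generators G') :=
    Finite.of_equiv (IsFreeGroup.Generators G) (Equiv.ofFreeGroupEquiv
      ((IsFreeGroup.toFreeGroup G).symm.trans (e.symm.trans (IsFreeGroup.toFreeGroup G'))))
  -- non-commuting elements `(a, 1)`, `(b, 1)`
  obtain ⟨a₀, rfl⟩ := QuotientGroup.mk_surjective a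
  obtain ⟨b₀, rfl⟩ := QuotientGroup.mk_surjective b
  have hmem : ∀ c : P, (QuotientGroup.mk c : P ⧸ N.toSubgroup) ∈ G →
      (QuotientGroup.mk (c, (1 : Γ)) : (P × Γ) ⧸ (onsProd N W).toSubgroup) ∈ G' := fun c hc =>
    Subgroup.mem_inf.mpr ⟨by change φ _ ∈ G; rw [hφ]; exact hc, by rw [MonoidHom.mem_ker, hψ]; rfl⟩
  refine ⟨G', hfree, hG'n, hG'fi, hfin, QuotientGroup.mk (a₀, 1), hmem a₀ ha,
    QuotientGroup.mk (b₀, 1), hmem b₀ hb, fun h => hab ?_⟩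
  have h2 := congrArg φ h
  simpa only [map_mul, hφ] using h2

end Products

end Literature.AnabelianGeometry.SemiGraphs

end
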